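import Summits.RiemannHypothesis.RiemannHypothesis.Theorems.Splittings.NbTailPolarisation
import HarnessLib

/-!
# Tail polarisation VIII, part 2/2 (NB-NEG): scheme collapses of the idle tails; polarisation by MODEL CLASS —
# cell `rh-split`, raw forms, ZERO defs; typed by rh-split-nb-neg g6, filed by rh-split-typer-1 g4

Second half (§TP.3–§TP.4) of the seat's `HOME/rh-split-nb-neg/g6/NbTailPolarisation.lean` (sha16 dac4471285db43a5, 439 l; referee
rh-split-ref g3 2026-08-27T04:25:56Z: §12 DELIVERABLE, CONTENT PASS «AS IS», farm rc 0 / 0 warn / 0 sorry, std axioms on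
`nb_tailFloor_iff_not_rh`, `nb_antiDoubling_of_not_rh`, `nb_rateLevel_refuted_by_zero_exp`, `rh_of_nb_tail_of_model`,
`transversal_monoUp_witness`), split only because of the 400-line rule; declarations byte-identical to the seat's; part 1 =
`NbTailPolarisation.lean` (§TP.0 logic, §TP.1 NB lower tails are `¬RH`-implied, §TP.2 visibility level).  Card
`run/shared/lean/pub/rh-split/cards/SPLIT-nb-neg.md` §12 (gen 6).

* §TP.3 (scheme collapses): the idle tails of §TP.1 inside a splitting scheme `FIN(H) ∧ T(H) ⟹ RH` collapse it to `FIN ⟹ RH`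
  (`nb_fin_alone_of_tailFloor_split`, `nb_fin_alone_of_lowerRateTail_scheme`, `nb_fin_alone_of_antiDoubling_scheme`,
  `natural_fin_alone_of_lowerTail_scheme`).
* §TP.4 (polarisation by MODEL CLASS — what the kernel knows about `N ↦ D(N)` off RH): `nb_tail_of_not_rh_of_model`,
  `rh_of_nb_tail_of_model`, and the transversal witness `transversal_monoUp_witness`.

Every statement spells `_root_.RiemannHypothesis`.  No definitions.

HONEST LABEL: «SPLITTING SEARCH over kernel-typed RH-EQUIVALENCES; a splitting A ∧ B ⟹ RH is CONDITIONAL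
bookkeeping unless A and B are both proved; nothing here bears on the truth of RH.»
-/

noncomputable section

-- D-0017: `Summit.<S>.<S>.…` is the designed namespace of a single-problem summit.
set_option linter.dupNamespace false

open Complex MeasureTheory Set Filter Topology
open scoped Real ENNReal

namespace Summit.RiemannHypothesis.RiemannHypothesis.Theorems.Splittings.NbTailPolarisation

open Summit.RiemannHypothesis.RiemannHypothesis.Theses.NymanBeurling
open Summit.RiemannHypothesis.RiemannHypothesis.Theorems
open Summit.RiemannHypothesis.RiemannHypothesis.Theorems.Splittings.NbSharpFloor
open Summit.RiemannHypothesis.RiemannHypothesis.Theorems.Splittings.CostumeDetectorsNbNeg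
open Summit.RiemannHypothesis.RiemannHypothesis.Theorems.Splittings.NbBddNatural

/-! ## §TP.3 — scheme collapses (the idle tails of §TP.1 inside a splitting) -/

/-- A splitting with a TAIL FLOOR conjunct at any level `H` is `FIN ⟹ RH` (the floor is `¬RH`).
[folklore] -/
theorem nb_fin_alone_of_tailFloor_split {A : Prop} {H : ℕ}
    (hsplit : A → (∃ c : ℝ, 0 < c ∧ ∀ N : ℕ, H ≤ N → ∀ a : Fin N → ℂ, ENNReal.ofReal c ≤
      ∫⁻ t : ℝ, ENNReal.ofReal (‖1 - riemannZeta (1 / 2 + t * Complex.I) *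
        ∑ n : Fin N, a n * ((n : ℂ) + 1) ^ (-(1 / 2 + t * Complex.I))‖ ^ 2 / (1 / 4 + t ^ 2))) →
      _root_.RiemannHypothesis) :
    A → _root_.RiemannHypothesis :=
  imp_rh_of_split_of_not_rh_imp (nb_tailFloor_iff_not_rh H).mpr hsplit

/-- A splitting SCHEME with a LOWER RATE tail (any constant `c`) collapses: from some level on the
finite conjunct gives RH by itself. [folklore] -/
theorem nb_fin_alone_of_lowerRateTail_scheme {A : ℕ → Prop} {c : ℝ} {H₁ : ℕ}
    (hsplit : ∀ H : ℕ, H₁ ≤ H → A H →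
      (∀ N : ℕ, H ≤ N → ∀ a : Fin N → ℂ, ENNReal.ofReal (c / Real.log N) ≤
        ∫⁻ t : ℝ, ENNReal.ofReal (‖1 - riemannZeta (1 / 2 + t * Complex.I) *
          ∑ n : Fin N, a n * ((n : ℂ) + 1) ^ (-(1 / 2 + t * Complex.I))‖ ^ 2 / (1 / 4 + t ^ 2))) →
      _root_.RiemannHypothesis) :
    ∃ H₂ : ℕ, H₁ ≤ H₂ ∧ ∀ H : ℕ, H₂ ≤ H → A H → _root_.RiemannHypothesis :=
  eventually_imp_rh_of_scheme
    (T := fun H ↦ ∀ N : ℕ, H ≤ N → ∀ a : Fin N → ℂ, ENNReal.ofReal (c / Real.log N) ≤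
        ∫⁻ t : ℝ, ENNReal.ofReal (‖1 - riemannZeta (1 / 2 + t * Complex.I) *
          ∑ n : Fin N, a n * ((n : ℂ) + 1) ^ (-(1 / 2 + t * Complex.I))‖ ^ 2 / (1 / 4 + t ^ 2)))
    (fun hRH ↦ by
      obtain ⟨H₀, h⟩ := nb_lowerRateTail_of_not_rh hRH c
      exact ⟨H₀, fun H hH N hN a ↦ h N (hH.trans hN) a⟩)
    hsplit

/-- A splitting SCHEME with an ANTI-DOUBLING tail (`θ < 1`) collapses likewise. [folklore] -/
theorem nb_fin_alone_of_antiDoubling_scheme {A : ℕ → Prop} {θ : ℝ} (hθ : θ < 1) {H₁ : ℕ}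
    (hsplit : ∀ H : ℕ, H₁ ≤ H → A H →
      (∀ N : ℕ, H ≤ N →
        θ * (⨅ a : Fin N → ℂ, ∫ t : ℝ, ‖1 - riemannZeta (1 / 2 + t * I) *
          ∑ n : Fin N, a n * ((n : ℂ) + 1) ^ (-(1 / 2 + t * I))‖ ^ 2 / (1 / 4 + t ^ 2)) <
        ⨅ a : Fin (N ^ 2) → ℂ, ∫ t : ℝ, ‖1 - riemannZeta (1 / 2 + t * I) *
          ∑ n : Fin (N ^ 2), a n * ((n : ℂ) + 1) ^ (-(1 / 2 + t * I))‖ ^ 2 / (1 / 4 + t ^ 2)) →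
      _root_.RiemannHypothesis) :
    ∃ H₂ : ℕ, H₁ ≤ H₂ ∧ ∀ H : ℕ, H₂ ≤ H → A H → _root_.RiemannHypothesis :=
  eventually_imp_rh_of_scheme
    (T := fun H ↦ ∀ N : ℕ, H ≤ N →
        θ * (⨅ a : Fin N → ℂ, ∫ t : ℝ, ‖1 - riemannZeta (1 / 2 + t * I) *
          ∑ n : Fin N, a n * ((n : ℂ) + 1) ^ (-(1 / 2 + t * I))‖ ^ 2 / (1 / 4 + t ^ 2)) <
        ⨅ a : Fin (N ^ 2) → ℂ, ∫ t : ℝ, ‖1 - riemannZeta (1 / 2 + t * I) *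
          ∑ n : Fin (N ^ 2), a n * ((n : ℂ) + 1) ^ (-(1 / 2 + t * I))‖ ^ 2 / (1 / 4 + t ^ 2))
    (fun hRH ↦ by
      obtain ⟨H₀, h⟩ := nb_antiDoubling_of_not_rh hRH hθ
      exact ⟨H₀, fun H hH N hN ↦ h N (hH.trans hN)⟩)
    hsplit

/-- A splitting SCHEME with a natural LOWER tail «`B < I(V_N)` beyond `H`» collapses likewise.
[folklore] -/
theorem natural_fin_alone_of_lowerTail_scheme {A : ℕ → Prop} {B : ℝ} {H₁ : ℕ}
    (hsplit : ∀ H : ℕ, H₁ ≤ H → A H →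
      (∀ N : ℕ, H ≤ N → ENNReal.ofReal B <
        ∫⁻ t : ℝ, ENNReal.ofReal (‖1 - riemannZeta (1 / 2 + t * Complex.I) *
          ∑ n : Fin N, ((ArithmeticFunction.moebius (n + 1) : ℝ) *
            (1 - Real.log ((n : ℝ) + 1) / Real.log N) : ℂ) * ((n : ℂ) + 1) ^ (-(1 / 2 + t * Complex.I))‖ ^ 2 /
              (1 / 4 + t ^ 2))) →
      _root_.RiemannHypothesis) :
    ∃ H₂ : ℕ, H₁ ≤ H₂ ∧ ∀ H : ℕ, H₂ ≤ H → A H → _root_.RiemannHypothesis :=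
  eventually_imp_rh_of_scheme
    (T := fun H ↦ ∀ N : ℕ, H ≤ N → ENNReal.ofReal B <
        ∫⁻ t : ℝ, ENNReal.ofReal (‖1 - riemannZeta (1 / 2 + t * Complex.I) *
          ∑ n : Fin N, ((ArithmeticFunction.moebius (n + 1) : ℝ) *
            (1 - Real.log ((n : ℝ) + 1) / Real.log N) : ℂ) * ((n : ℂ) + 1) ^ (-(1 / 2 + t * Complex.I))‖ ^ 2 /
              (1 / 4 + t ^ 2)))
    (fun hRH ↦ by
      obtain ⟨H₀, h⟩ := natural_lowerTail_of_not_rh hRH B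
      exact ⟨H₀, fun H hH N hN ↦ h N (hH.trans hN)⟩)
    hsplit

/-! ## §TP.4 — polarisation by MODEL CLASS (what the kernel knows about `N ↦ D(N)` off RH) -/

/-- **Model class, idle side.** Everything the kernel knows about the sequence `D(N) = inf_a ∫ …` in a
non-RH world is: antitone (`nb_dist_antitone`), `≤ 2π` (`nb_dist_le_two_pi`), and bounded below by a
positive constant (`nb_dist_floor_pos_of_not_rh`; plus the per-zero floors of `NbSharpFloor`).  Hence a
tail property `T` holding for EVERY antitone real sequence with a positive floor and `≤ 2π` is
`¬RH`-implied for `D` — idle as a conjunct.  A tail property that this class neither forces nor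
forbids («transversal»: e.g. eventual monotonicity of `D(N)·log N`) is undecided by everything in the
tree, so a splitting using it would be a new theorem on the fine structure of `d_N` off RH, not
bookkeeping. [folklore] -/
theorem nb_tail_of_not_rh_of_model {T : (ℕ → ℝ) → Prop}
    (hT : ∀ E : ℕ → ℝ, Antitone E → (∃ c : ℝ, 0 < c ∧ ∀ N, c ≤ E N) → (∀ N, E N ≤ 2 * π) → T E)
    (hRH : ¬ _root_.RiemannHypothesis) :
    T (fun N ↦ ⨅ a : Fin N → ℂ, ∫ t : ℝ, ‖1 - riemannZeta (1 / 2 + t * I) *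
        ∑ n : Fin N, a n * ((n : ℂ) + 1) ^ (-(1 / 2 + t * I))‖ ^ 2 / (1 / 4 + t ^ 2)) :=
  hT _ nb_dist_antitone (nb_dist_floor_pos_of_not_rh hRH) nb_dist_le_two_pi

/-- **Model class, costume side.** A tail property failing for EVERY antitone real sequence with a
positive floor and `≤ 2π` gives RH on its own when asserted of `D` (contrapositive of the idle
side); e.g. every «`D → 0` along a subsequence» tail (the LABEL LEMMA family of the card, §8).
[folklore] -/
theorem rh_of_nb_tail_of_model {T : (ℕ → ℝ) → Prop}
    (hT : ∀ E : ℕ → ℝ, Antitone E → (∃ c : ℝ, 0 < c ∧ ∀ N, c ≤ E N) → (∀ N, E N ≤ 2 * π) → ¬ T E)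
    (h : T (fun N ↦ ⨅ a : Fin N → ℂ, ∫ t : ℝ, ‖1 - riemannZeta (1 / 2 + t * I) *
        ∑ n : Fin N, a n * ((n : ℂ) + 1) ^ (-(1 / 2 + t * I))‖ ^ 2 / (1 / 4 + t ^ 2))) :
    _root_.RiemannHypothesis :=
  Classical.byContradiction fun hRH ↦
    hT _ nb_dist_antitone (nb_dist_floor_pos_of_not_rh hRH) nb_dist_le_two_pi h

/-- **A transversal tail exists in the model class (witness pair).** The property «`E(N)·log N` is
non-decreasing for `N ≥ 2`» HOLDS for the constant sequence `E = 1` and FAILS for the antitone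
floor-`1` sequence `E(N) = if N ≤ 2 then 2 else 1` (drop at `N = 3`: `2 log 2 > log 3`), both members
of the class {antitone, floor `> 0`, `≤ 2π`}: so eventual monotonicity of `D(N) log N` is decided by
NEITHER polarisation lemma — it is transversal. [folklore] -/
theorem transversal_monoUp_witness :
    (Antitone (fun _ : ℕ ↦ (1 : ℝ)) ∧ (∃ c : ℝ, 0 < c ∧ ∀ N : ℕ, c ≤ (fun _ : ℕ ↦ (1 : ℝ)) N) ∧
      (∀ N : ℕ, (fun _ : ℕ ↦ (1 : ℝ)) N ≤ 2 * π) ∧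
      (∀ N : ℕ, 2 ≤ N → (fun _ : ℕ ↦ (1 : ℝ)) N * Real.log N ≤
        (fun _ : ℕ ↦ (1 : ℝ)) (N + 1) * Real.log ((N + 1 : ℕ) : ℝ))) ∧
    (Antitone (fun N : ℕ ↦ if N ≤ 2 then (2 : ℝ) else 1) ∧
      (∃ c : ℝ, 0 < c ∧ ∀ N : ℕ, c ≤ (fun N : ℕ ↦ if N ≤ 2 then (2 : ℝ) else 1) N) ∧
      (∀ N : ℕ, (fun N : ℕ ↦ if N ≤ 2 then (2 : ℝ) else 1) N ≤ 2 * π) ∧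
      ¬ (∀ N : ℕ, 2 ≤ N → (fun N : ℕ ↦ if N ≤ 2 then (2 : ℝ) else 1) N * Real.log N ≤
        (fun N : ℕ ↦ if N ≤ 2 then (2 : ℝ) else 1) (N + 1) * Real.log ((N + 1 : ℕ) : ℝ))) := by
  refine ⟨⟨fun _ _ _ ↦ le_rfl, ⟨1, one_pos, fun _ ↦ le_rfl⟩, fun _ ↦ by linarith [Real.pi_gt_three],
    fun N hN ↦ ?_⟩, ⟨?_, ⟨1, one_pos, fun N ↦ ?_⟩, fun N ↦ ?_, ?_⟩⟩
  · simp only [one_mul]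
    exact Real.log_le_log (by positivity) (by push_cast; linarith)
  · intro m n hmn
    simp only
    split_ifs with h1 h2 h2 <;> first | exact le_rfl | (exfalso; omega) | norm_num
  · simp only; split_ifs <;> norm_num
  · simp only; split_ifs <;> linarith [Real.pi_gt_three]
  · intro h
    have h2 := h 2 le_rfl
    simp only [le_refl, if_true, show ¬ (2 + 1 ≤ 2) from by omega, if_false, one_mul] at h2
    -- h2 : 2 * log 2 ≤ log 3, but 2 log 2 = log 4 > log 3
    have h4 : (2 : ℝ) * Real.log (2 : ℕ) = Real.log 4 := by
      rw [show ((2 : ℕ) : ℝ) = 2 by norm_num, ← Real.log_rpow two_pos]; norm_num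
    have h3 : Real.log 4 > Real.log ((2 + 1 : ℕ) : ℝ) := by
      rw [show ((2 + 1 : ℕ) : ℝ) = 3 by norm_num]
      exact Real.log_lt_log (by norm_num) (by norm_num)
    linarith

end Summit.RiemannHypothesis.RiemannHypothesis.Theorems.Splittings.NbTailPolarisation

end
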